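import Summits.BirchSwinnertonDyer.BirchSwinnertonDyer.Theorems.ByReductionTypeAtTwoSupersingularFlatBlindCardGlueLineCard
import Summits.BirchSwinnertonDyer.BirchSwinnertonDyer.Theorems.ByReductionTypeAtTwoSupersingularFlatBlindCardPosition
import Summits.BirchSwinnertonDyer.BirchSwinnertonDyer.Theorems.ByReductionTypeAtTwoSupersingularFlatBlindCardPositionLocal
import Summits.BirchSwinnertonDyer.BirchSwinnertonDyer.Theorems.ByReductionTypeAtTwoSupersingularFlatBlindTwistSideDictionaryExact
import Summits.BirchSwinnertonDyer.BirchSwinnertonDyer.Theorems.ByReductionTypeAtTwoSupersingularFlatBlindTamagawaSplitting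
import Summits.BirchSwinnertonDyer.BirchSwinnertonDyer.Theorems.ByReductionTypeAtTwoSupersingularFlatBlindLineHand
import Summits.BirchSwinnertonDyer.Rank1Residual.X11b.LocalPrimaryCohomologyEP
import HarnessLib

/-!
# Route `ByReductionTypeAtTwo` (rung K4), crux `SupersingularRankZeroAtTwo` (item stmt-BirchSwinnertonDyer-19097), line
# `odd_blind_package` (registry v2.10.1), slot 5 `stub_CD` = CDC_H `OddBlindPackage.FlatBlindControlCardHondaAtTwo`:
# **CDC_H DOWN TO THE PRINT BINDER hPT AND ONE GENERIC BINDER (hglob)** (cell `bsd-2adic`, LEAD ss-1 GEN 22)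

HONEST FRAMING: THEOREMS ONLY (no definition, no named fact, no `sorry`, no instance); a helper (`--supports stmt-BirchSwinnertonDyer-19097`).
`flatBlindControlCardHondaAtTwo_of_glob (hPT) (hglob)` closes every line-specific binder of the re-cut glue
`flatBlindControlCardHondaAtTwo_of_lineCard` BY NAME: (hB1) = ★★ p817249 `FlatBlindTwistSide.HTC5_dictionary`, (hB2') = ★★ p818264
`FlatBlindTamagawaSplitting.HTC6_tamagawa_of_lineCard hPT` (print binder `hPT` = Poitou–Tate duality for finite Selmer structures over `ℚ`
with the real places, Milne ADT I 4.10 — a `def … : Prop` of Literature, taken as a hypothesis, NOT proved here), (hE) = ★★★ p819388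
`HTC7locE_flatLine_transversal_and_card`, (hB3) = ★★ p816472 `position_of_complement_of_lineCount` fed with ★★ p816496
`lineComplement_of_transversal_of_lineCard (hE) (EP)` — the local Euler–Poincaré characteristic `EP` being the tree theorem
`X11b.LocBridge.localEulerPoincareCharacteristic_adicCompletionEP` (Milne ADT I 2.8) — and (hB5) = ★ p815278
`valuation_sub_padicValNat_index_eq_of_generator`. What remains is ONE generic binder (hglob) = «position count for a complementary line»
(any `E/ℚ`, prime `p`, `v ∣ p`, no `p`-torsion locally/globally, rank one, `Ш[p^∞]` finite) = (P1) the relaxed-vs-strict Poitou–Tate count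
(★★ p819324 `HTC7globPT_natCard_kummerRelaxed_eq (hPT)`) + (P2) the position algebra (LEAD hand, to land; then `(hPT) → CDC_H` is appended here).
So after this file: **CDC_H ⇐ hPT ∧ (hglob)** on the tree. Nothing booked; 19097 stays OPEN; BSD is proved for no curve. bears_on: K4 (19097).

References: [MilneADT2006] I Thm. 2.8, I Thm. 4.10; [GreenbergLNM1716] §4.
-/

set_option autoImplicit false
set_option linter.dupNamespace false

noncomputable section

open scoped Classical NumberField AddSubgroup ContRepresentation

namespace Summit.BirchSwinnertonDyer.BirchSwinnertonDyer.Theorems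

namespace OddBlindLocal

open NumberField IsDedekindDomain Field WeierstrassCurve Literature.NumberTheory.EllipticCurves
  Literature.NumberTheory.EllipticCurves.IwasawaDual Literature.NumberTheory.GaloisRepresentations
  Literature.NumberTheory.GaloisCohomology ZpExtension Literature.NumberTheory.EllipticCurves.Kobayashi2003
  Literature.NumberTheory.EllipticCurves.Sprung2017 Literature.NumberTheory.EllipticCurves.Sprung2012
  Literature.NumberTheory.EllipticCurves.Rank1Residual Summit.BirchSwinnertonDyer.Rank1Residual.Additive
open Literature.NumberTheory.GaloisRepresentations.DiscreteGaloisModule (SelmerStructure)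

/-- ★★★ **CDC_H MODULO hPT AND ONE GENERIC BINDER.** `OddBlindPackage.FlatBlindControlCardHondaAtTwo` (body VERBATIM) from the print binder
`hPT` (Poitou–Tate duality for finite Selmer structures over `ℚ` with the real places; Milne ADT I 4.10) and (hglob) = the generic «position count
for a complementary line», every line-specific binder of the re-cut glue being DISCHARGED BY NAME: (B1) `FlatBlindTwistSide.HTC5_dictionary` (★★ p817249),
(B2') `FlatBlindTamagawaSplitting.HTC6_tamagawa_of_lineCard hPT` (★★ p818264), (hE) `HTC7locE_flatLine_transversal_and_card` (★★★ p819388),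
(B3) `position_of_complement_of_lineCount (lineComplement_of_transversal_of_lineCard hE EP) hglob` (★★ p816472, ★★ p816496; `EP` = the tree theorem
`X11b.LocBridge.localEulerPoincareCharacteristic_adicCompletionEP ℚ v`, Milne ADT I 2.8), (B5) `valuation_sub_padicValNat_index_eq_of_generator` (★ p815278).
HONEST: a REDUCTION — CDC_H ⇐ hPT ∧ (hglob); (hglob) = (P1) ★★ p819324 + (P2) (LEAD hand, to land); 19097 stays OPEN; BSD is proved for no curve.
[cite: MilneADT2006, I Thm. 2.8, I Thm. 4.10] [cite: GreenbergLNM1716, §4 pp. 122–124] -/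
theorem flatBlindControlCardHondaAtTwo_of_glob
    (hPT : Literature.NumberTheory.GaloisCohomology.poitouTate_selmerStructure_duality_real ℚ)
    (hglob : ∀ (E : WeierstrassCurve ℚ) [E.IsElliptic] (p : ℕ) [Fact p.Prime]
      (v : HeightOneSpectrum (𝓞 ℚ)), ((p : ℕ) : 𝓞 ℚ) ∈ v.asIdeal →
      (∀ P : (E.baseChange (v.adicCompletion ℚ)).toAffine.Point, p • P = 0 → P = 0) →
      (∀ P : (E.baseChange ℚ_[p]).toAffine.Point, p • P = 0 → P = 0) →
      (∀ P : E.toAffine.Point, p • P = 0 → P = 0) →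
      E.mordellWeilRank = 1 → Finite (AddCommGroup.primaryComponent E.sha p) →
      ∃ J₂ : ℕ, ∀ J : ℕ, J₂ ≤ J →
      ∀ (L : AddSubgroup (galoisCohomology ((E.torsionGaloisModule ((p ^ J : ℕ) : ℤ)).restrictField (v.adicCompletion ℚ)) 1)),
        L ⊓ E.kummerLocalConditionAt ((p ^ J : ℕ) : ℤ) (v.adicCompletion ℚ) = ⊥ →
        L ⊔ E.kummerLocalConditionAt ((p ^ J : ℕ) : ℤ) (v.adicCompletion ℚ) = ⊤ →
      ∀ (𝓛 : SelmerStructure (E.torsionGaloisModule ((p ^ J : ℕ) : ℤ))),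
        (∀ w : InfinitePlace ℚ, 𝓛 (Sum.inl w) = E.kummerLocalConditionAt ((p ^ J : ℕ) : ℤ) w.Completion) →
        𝓛 (Sum.inr v) = L →
        (∀ v' : HeightOneSpectrum (𝓞 ℚ), v' ≠ v → 𝓛 (Sum.inr v') = E.kummerLocalConditionAt ((p ^ J : ℕ) : ℤ) (v'.adicCompletion ℚ)) →
      ∀ (lam : (E.baseChange ℚ_[p]).toAffine.Point →+ ℤ_[p]), (∀ X, lam X = 0 ↔ IsOfFinAddOrder X) → Function.Surjective lam →
      ∀ (P₁ : E.toAffine.Point), (∀ P : E.toAffine.Point, ∃ (a : ℤ) (t : E.toAffine.Point), IsOfFinAddOrder t ∧ P = a • P₁ + t) →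
        Nat.card 𝓛.selmerGroup =
          Nat.card ↥(E.selmerGroupPInfty p ⊓ selmerLocalKerPrimaryTorsion E ℚ_[p] p) *
            p ^ (lam (Affine.Point.baseChange (W' := E) ℚ ℚ_[p] P₁)).valuation) :
    ∀ (W : WeierstrassCurve ℚ) [W.IsElliptic] [W.IsGloballyMinimal],
    ¬ W.HasCM → GoodSS W 2 → W.rootNumber * ZMod.χ₈ (W.conductorNorm ℤ : ZMod 8) = -1 →
    ∀ (κ : ZpExtension ℚ 2) (γ : Field.absoluteGaloisGroup ℚ),
      κ.IsCyclotomic → κ.IsTopGenerator γ → IsCyclotomicVariable 2 γ →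
    ∀ (v : HeightOneSpectrum (𝓞 ℚ)), (2 : 𝓞 ℚ) ∈ v.asIdeal →
    ∀ (g : Field.absoluteGaloisGroup (v.adicCompletion ℚ)) (c : ℕ → localPoints W (v.adicCompletion ℚ)),
      κ.IsTopGenerator (resGalOfEmb (closureEmb (K := ℚ) (v.adicCompletion ℚ)) g) →
      (∀ n, c n ∈ localLayerPointsOfEmb κ (closureEmb (K := ℚ) (v.adicCompletion ℚ)) W n) →
      (∀ n, 1 ≤ n → localTraceOfEmb κ (closureEmb (K := ℚ) (v.adicCompletion ℚ)) W n (n + 1)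
        (c (n + 1)) = W.frobeniusTrace 2 • c n - c (n - 1)) →
      (∀ z₀ : localLayerPointsOfEmb κ (closureEmb (K := ℚ) (v.adicCompletion ℚ)) W 0 →+ ℤ_[2],
        evalOn W (localLayerPointsOfEmb κ (closureEmb (K := ℚ) (v.adicCompletion ℚ)) W 0) z₀ (c 0) = 0 →
          z₀ = 0) →
      (∀ a : ℤ_[2],
        (∃ z₀ : localLayerPointsOfEmb κ (closureEmb (K := ℚ) (v.adicCompletion ℚ)) W 0 →+ ℤ_[2],
          evalOn W (localLayerPointsOfEmb κ (closureEmb (K := ℚ) (v.adicCompletion ℚ)) W 0) z₀ (c 0) = 2 * a) →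
        ∃ y : localLayerPointsOfEmb κ (closureEmb (K := ℚ) (v.adicCompletion ℚ)) W 0 →+ ℤ_[2],
          evalOn W (localLayerPointsOfEmb κ (closureEmb (K := ℚ) (v.adicCompletion ℚ)) W 0) y (c 0) = a) →
      (∃ cneg : localPoints W (v.adicCompletion ℚ),
        Summit.BirchSwinnertonDyer.Rank1Residual.F1Sign2.IsHondaSystemAtTwo κ (closureEmb (K := ℚ) (v.adicCompletion ℚ)) W
          (W.frobeniusTrace 2) g cneg c) →
    ∀ (W₂ : WeierstrassCurve ℚ) [W₂.IsElliptic] [W₂.IsGloballyMinimal],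
      (∃ C : WeierstrassCurve.VariableChange ℚ, C • W.quadraticTwist 2 = W₂) →
      W₂.mordellWeilRank = 1 → Finite (AddCommGroup.primaryComponent W₂.sha 2) →
    ∀ (ι : ℚ →+* ℚ_[2]) (P : (W₂.baseChange ℚ).toAffine.Point), ¬ IsOfFinAddOrder P →
      Finite (endInvariants (conjSharpFlatSelmerInfty W κ (closureEmb (K := ℚ) (v.adicCompletion ℚ))
        (W.frobeniusTrace 2) g c .flat γ + 1)) →
      (padicValNat 2 (Nat.card (endInvariants (conjSharpFlatSelmerInfty W κ
          (closureEmb (K := ℚ) (v.adicCompletion ℚ)) (W.frobeniusTrace 2) g c .flat γ + 1))) : ℤ) =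
        (padicValNat 2 (Nat.card (AddCommGroup.primaryComponent W₂.sha 2)) : ℤ) +
          (padicValNat 2 W₂.tamagawaProduct : ℤ) +
          2 * (Literature.NumberTheory.EllipticCurves.padicLogOrd W₂ 2 ι P -
            (padicValNat 2 (AddSubgroup.zmultiples P).index : ℤ)) :=
  flatBlindControlCardHondaAtTwo_of_lineCard FlatBlindTwistSide.HTC5_dictionary
    (FlatBlindTamagawaSplitting.HTC6_tamagawa_of_lineCard hPT) HTC7locE_flatLine_transversal_and_card
    (position_of_complement_of_lineCount
      (lineComplement_of_transversal_of_lineCard HTC7locE_flatLine_transversal_and_card fun v _ ↦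
        Summit.BirchSwinnertonDyer.Rank1Residual.X11b.LocBridge.localEulerPoincareCharacteristic_adicCompletionEP ℚ v)
      hglob)
    valuation_sub_padicValNat_index_eq_of_generator

end OddBlindLocal

end Summit.BirchSwinnertonDyer.BirchSwinnertonDyer.Theorems

end
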